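import Summits.ABC.IUTFork.Cor312GenuineKWildLowerBound
import Literature.IUT.LogVolume.SubThetaFieldRamificationWild
import Literature.IUT.LogVolume.GenuineThetaFieldCyclotomicRamification
import Literature.IUT.LogVolume.Corollary22RatPointDictionary
import HarnessLib

/-!
# [IUTchIII] Cor. 3.12, branch C / R-W window table — the EXACT wild local type at the `K`-level pilot datum:
# `e(K_{x₀}/ℚ_p) = p·(p − 1)·r·l` at every fibre point `x₀ ∣ p ∈ {3, 5}` over a pole of `j` of order `2t`, `p ∤ t`
# (`r = p′/gcd(p′, t)`, `{p, p′} = {3, 5}`) — GAP G-Wnum2-1 (i) closed at the W1 packets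

PROOF-ONLY support file (D-0012; 0 definitions, 0 `Prop` facts) of the abc-iut cell (R-W «WINDOW Θ-SIDE INEQUALITY», seat
abc-iut-W-neg-1 gen 2). TAKES NO SIDE on [IUTchIII] Cor. 3.12 (S. Mochizuki, *Inter-universal Teichmüller theory III*,
Cor. 3.12 p. 173–174) or on any author.

For a genuine Θ-volume datum `T : Cor22.ThetaVolumeDatumAt (ratPoint q₀) l`, primes `{p, p′} = {3, 5}` with `p ≠ l`, a pole of
`j(q₀)` at `p` of order `2t` with `p ∤ t` (type W1 of the window table), the UPPER half
(`Cor22.ramificationIdx_subThetaField_dvd_wild`, `…_of_dvd_ord`: `e(w | p) ∣ p(p−1)p′`, resp. `∣ p(p−1)` when `p′ ∣ t`; Serre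
1972 §1.12 via Serre's line and the Weil pairing) meets the LOWER half (`(p − 1) ∣ e(w | p)`: `μ₃₀ ⊂ F`,
`ThetaVolumeDatumAt.sub_one_dvd_ramificationIdx_int`; `15 ∣ e(w | p)·t`: the `30`-th root of the Tate parameter,
`ThetaVolumeDatumAt.fifteen_dvd_ramificationIdx_mul`; `e(u | w) = l`: `GenuineK.absRamificationIdx_kOf_eq_mul_prime_ratPoint`):

* `GenuineK.ramificationIdx_F_eq_wild_ratPoint` — **`e(w | p) = p·(p − 1)·(p′/gcd(p′, t))`** for every place `w ∣ p` of `F`;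
* **`GenuineK.absRamificationIdx_kOf_eq_wild_ratPoint`** — **`e(K_{x₀}/ℚ_p) = p·(p − 1)·(p′/gcd(p′, t))·l`** at every fibre point
  `x₀ ∣ p` of `pilotDataOfK T.D T.K` — W-num-2's exact value `e_w = l·e_W·r` (N1-WILD-EXACT L4, type W1: `e_W = p(p−1)`).

HONEST FRAMING: bookkeeping over OUR typed objects (classical local type of the genuine tower); nothing here bears on the
printed inequality of [IUTchIII] Cor. 3.12 or on the number-level `Cor22.Cor312AtDatum`; typed ≠ proved; instantiated ≠ endorsed.
[cite: Serre1972, §1.11–§1.12] [cite: Mochizuki2012, IUTchIV Thm. 1.10 p. 22 and proof Step (iii) (R2)–(R4) p. 25–26]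
[cite: SilvermanATAEC1994, V.5 Thm. 5.3] [claim: Mochizuki2012, status: disputed] for every IUT quotation.
-/

noncomputable section

open NumberField IsDedekindDomain

namespace Summit.ABC.IUTFork.Conditional

open Thm311 Thm311.Real Cor312 Cor312Prov Literature.IUT.LogVolume Literature.IUT.HodgeTheaters
  Literature.IUT.LogThetaLattice Literature.NumberTheory.NumberFields Literature.NumberTheory.DiophantineGeometry.GenEll
  Literature.NumberTheory.DiophantineGeometry

/-- The arithmetic of the two bounds: `(p−1) ∣ A`, `15 ∣ A·t`, `A ∣ p(p−1)p′` (and `A ∣ p(p−1)` when `p′ ∣ t`), `p ∤ t`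
force `A = p(p−1)·p′/gcd(p′, t)` for `{p, p′} = {3, 5}`. [folklore] -/
private theorem wild_index_eq {p q t A : ℕ} (hpq : (p = 3 ∧ q = 5) ∨ (p = 5 ∧ q = 3)) (hpt : ¬ p ∣ t)
    (h1 : (p - 1) ∣ A) (h15 : 15 ∣ A * t) (hup : A ∣ p * (p - 1) * q) (hup' : q ∣ t → A ∣ p * (p - 1)) :
    A = p * (p - 1) * (q / Nat.gcd q t) := by
  rcases hpq with ⟨rfl, rfl⟩ | ⟨rfl, rfl⟩
  · have h3 : 3 ∣ A := ((Nat.Prime.coprime_iff_not_dvd Nat.prime_three).mpr hpt).dvd_of_dvd_mul_right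
      (dvd_trans (by norm_num) h15)
    have h2 : 2 ∣ A := by simpa using h1
    have h6 : 6 ∣ A := Nat.Coprime.mul_dvd_of_dvd_of_dvd (by norm_num) h2 h3
    by_cases h5 : 5 ∣ t
    · have hA : A ∣ 6 := by simpa using hup' h5
      rw [Nat.gcd_eq_left h5]
      norm_num
      exact Nat.dvd_antisymm hA h6
    · have hcop : Nat.Coprime 5 t := (Nat.Prime.coprime_iff_not_dvd Nat.prime_five).mpr h5
      have h5A : 5 ∣ A := hcop.dvd_of_dvd_mul_right (dvd_trans (by norm_num) h15)
      have h30 : 30 ∣ A := Nat.Coprime.mul_dvd_of_dvd_of_dvd (by norm_num) h6 h5A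
      have hA : A ∣ 30 := by simpa using hup
      rw [Nat.Coprime.gcd_eq_one hcop]
      norm_num
      exact Nat.dvd_antisymm hA h30
  · have h5 : 5 ∣ A := ((Nat.Prime.coprime_iff_not_dvd Nat.prime_five).mpr hpt).dvd_of_dvd_mul_right
      (dvd_trans (by norm_num) h15)
    have h4 : 4 ∣ A := by simpa using h1
    have h20 : 20 ∣ A := Nat.Coprime.mul_dvd_of_dvd_of_dvd (by norm_num) h4 h5
    by_cases h3 : 3 ∣ t
    · have hA : A ∣ 20 := by simpa using hup' h3
      rw [Nat.gcd_eq_left h3]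
      norm_num
      exact Nat.dvd_antisymm hA h20
    · have hcop : Nat.Coprime 3 t := (Nat.Prime.coprime_iff_not_dvd Nat.prime_three).mpr h3
      have h3A : 3 ∣ A := hcop.dvd_of_dvd_mul_right (dvd_trans (by norm_num) h15)
      have h60 : 60 ∣ A := Nat.Coprime.mul_dvd_of_dvd_of_dvd (by norm_num) h20 h3A
      have hA : A ∣ 60 := by simpa using hup
      rw [Nat.Coprime.gcd_eq_one hcop]
      norm_num
      exact Nat.dvd_antisymm hA h60

/-- **`e(w | p) = p·(p − 1)·(p′/gcd(p′, t))` for every place `w ∣ p ∈ {3, 5}` of the field `F` of a genuine Θ-volume datum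
at `(ratPoint q₀, l)` over a pole of `j(q₀)` of order `2t` with `p ∤ t`** (`{p, p′} = {3, 5}`): the UPPER bound of
`Cor22.ramificationIdx_subThetaField_dvd_wild` (`_of_dvd_ord` when `p′ ∣ t`) against the LOWER divisibilities `(p−1) ∣ e`
(`μ₃₀ ⊂ F`) and `15 ∣ e·t` (the `30`-th root of the Tate parameter). This is W-num-2's `e(F_w/ℚ_p) = e_W·r`, `e_W = p(p−1)`,
type W1. [cite: Serre1972, §1.11–§1.12] [cite: Mochizuki2012, IUTchIV Thm. 1.10 p. 22] [claim: Mochizuki2012, status: disputed] -/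
theorem GenuineK.ramificationIdx_F_eq_wild_ratPoint {q₀ : ℚ} {l : ℕ} (T : Cor22.ThetaVolumeDatumAt (ratPoint q₀) l)
    {p p' : ℕ} (hpq : (p = 3 ∧ p' = 5) ∨ (p = 5 ∧ p' = 3)) {t : ℕ} (ht : 0 < t) (hpt : ¬ p ∣ t)
    (hpole : ∀ v : HeightOneSpectrum (𝓞 ℚ), Rat.HeightOneSpectrum.natGenerator v = p →
      Literature.IUT.LogVolume.ord ℚ v (Cor22.jInv q₀) = -(2 * (t : ℤ)))
    (w : letI := T.instFieldF; letI := T.instNumberFieldF; HeightOneSpectrum (𝓞 T.F))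
    (hw : letI := T.instFieldF; letI := T.instNumberFieldF; ((p : ℕ) : 𝓞 T.F) ∈ w.asIdeal) :
    (letI := T.instFieldF; letI := T.instNumberFieldF; w.asIdeal.ramificationIdx ℤ) =
      p * (p - 1) * (p' / Nat.gcd p' t) := by
  letI := T.instFieldF; letI := T.instNumberFieldF; letI := T.instAlgebraF; letI := T.instFieldK
  letI := T.instNumberFieldK; letI := T.instAlgebraK; letI := T.instFieldFbar; letI := T.instAlgebraFbar
  letI := T.instAlgebraKFbar; letI := T.instIsElliptic
  have hp : p.Prime := by rcases hpq with ⟨rfl, -⟩ | ⟨rfl, -⟩ <;> norm_num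
  have hp30 : p ∣ 30 := by rcases hpq with ⟨rfl, -⟩ | ⟨rfl, -⟩ <;> norm_num
  haveI : Fact p.Prime := ⟨hp⟩
  haveI : IsGalois (ratPoint q₀).F T.F := (T.towerFacts T.inU).1
  have ht0 : (0 : ℤ) < t := by exact_mod_cast ht
  -- the place `v₀` of `ℚ` under `w` is `p`
  set v₀ : HeightOneSpectrum (𝓞 ℚ) := finBelow (ratPoint q₀).F T.F w with hv₀def
  have hchar : residueChar ℚ v₀ = p := by
    rw [hv₀def]
    change residueChar (ratPoint q₀).F (finBelow (ratPoint q₀).F T.F w) = p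
    rw [residueChar_finBelow]
    exact residueChar_eq_of_natCast_mem p hw
  have hpv : ((p : ℕ) : 𝓞 ℚ) ∈ v₀.asIdeal := (Cor22.natCast_mem_asIdeal_iff_residueChar_eq v₀ hp).2 hchar
  have hvp : Rat.HeightOneSpectrum.natGenerator v₀ = p := by
    have hdvd := (UniformABCConjecture.natCast_mem_asIdeal_iff v₀ p).1 hpv
    exact (Nat.prime_dvd_prime_iff_eq (Rat.HeightOneSpectrum.prime_natGenerator v₀) hp).1 hdvd
  have hord := hpole v₀ hvp
  have hbad : v₀ ∈ Cor22.badPlaces (ratPoint q₀) :=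
    (Cor22.mem_badPlaces_iff_ord_neg (ratPoint q₀) v₀).2 (by
      show Literature.IUT.LogVolume.ord ℚ v₀ (Cor22.jInv q₀) < 0
      rw [hord]; linarith)
  have hp1 : Literature.IUT.LogVolume.ord ℚ v₀ (p : ℚ) = 1 := by
    rw [← hvp]
    exact Cor22.ord_natGenerator_eq_one v₀
  -- `e(w | p) = e(w | v₀)` over `ℚ`
  have hew : w.asIdeal.ramificationIdx ℤ = w.asIdeal.ramificationIdx (𝓞 (ratPoint q₀).F) := by
    haveI : (finBelow (ratPoint q₀).F T.F w).asIdeal.IsMaximal := (finBelow (ratPoint q₀).F T.F w).isMaximal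
    have h1 : ramIdx (ratPoint q₀).F (w.under (𝓞 (ratPoint q₀).F)) = 1 := by
      rw [ramIdx_eq]
      exact Literature.NumberTheory.EllipticCurves.Fisher2016.ramificationIdx_int_rat_eq_one _
    rw [ThetaData.absRamificationIdx_eq_ramIdx_mul (F := (ratPoint q₀).F) w]
    erw [h1, one_mul]
    exact Ideal.ramificationIdx'_eq_ramificationIdx (finBelow (ratPoint q₀).F T.F w).asIdeal w.asIdeal
      (finBelow (ratPoint q₀).F T.F w).ne_bot
  -- UPPER: `e(w | v₀) ∣ p(p−1)p′`, and `∣ p(p−1)` when `p′ ∣ t`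
  have hup : w.asIdeal.ramificationIdx (𝓞 (ratPoint q₀).F) ∣ p * (p - 1) * p' :=
    Cor22.ramificationIdx_subThetaField_dvd_wild T.F T.inU T.isSubThetaField w hbad hpq hpv hp1
  have hup' : p' ∣ t → w.asIdeal.ramificationIdx (𝓞 (ratPoint q₀).F) ∣ p * (p - 1) := fun hqt =>
    Cor22.ramificationIdx_subThetaField_dvd_wild_of_dvd_ord T.F T.inU T.isSubThetaField w hbad hpq hpv hp1 (by
      show ((p' : ℕ) : ℤ) ∣ Literature.IUT.LogVolume.ord ℚ v₀ (Cor22.jInv q₀)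
      rw [hord, dvd_neg]
      exact dvd_mul_of_dvd_right (Int.natCast_dvd_natCast.mpr hqt) 2)
  -- LOWER: `(p − 1) ∣ e(w | p)` and `15 ∣ e(w | v₀)·t`
  have h1 : (p - 1) ∣ w.asIdeal.ramificationIdx (𝓞 (ratPoint q₀).F) := by
    rw [← hew]
    exact T.sub_one_dvd_ramificationIdx_int hp hp30 w hw
  have h15 : 15 ∣ w.asIdeal.ramificationIdx (𝓞 (ratPoint q₀).F) * t :=
    T.fifteen_dvd_ramificationIdx_mul w (by rw [← hv₀def]; exact hord) ht
  rw [hew]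
  exact wild_index_eq hpq hpt h1 h15 hup hup'

/-- **THE EXACT WILD LOCAL TYPE: `e(K_{x₀}/ℚ_p) = p·(p − 1)·(p′/gcd(p′, t))·l`** at every fibre point `x₀ ∣ p ∈ {3, 5}`
(`p ≠ l`, `{p, p′} = {3, 5}`) of the pilot datum `pilotDataOfK T.D T.K` of a genuine Θ-volume datum at `(ratPoint q₀, l)` over a
pole of `j(q₀)` of order `2t` with `p ∤ t` (type W1): the `l`-division layer contributes exactly `l`
(`GenuineK.absRamificationIdx_kOf_eq_mul_prime_ratPoint`) over `ramificationIdx_F_eq_wild_ratPoint`. GAP G-Wnum2-1 (i) of the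
abc-iut R-W window table: `e = l·e_W·r`, `e_W = p(p−1)`, `r = p′/gcd(p′, t)` (W-num-2 N1-WILD-EXACT L4).
[cite: Serre1972, §1.11–§1.12] [cite: Mochizuki2012, IUTchI Ex. 3.2 (iv) p. 71; IUTchIV Thm. 1.10 p. 22]
[claim: Mochizuki2012, status: disputed] -/
theorem GenuineK.absRamificationIdx_kOf_eq_wild_ratPoint {q₀ : ℚ} {l : ℕ} (T : Cor22.ThetaVolumeDatumAt (ratPoint q₀) l)
    (pp : Nat.Primes) {p' : ℕ} (hpq : ((pp : ℕ) = 3 ∧ p' = 5) ∨ ((pp : ℕ) = 5 ∧ p' = 3)) (hpl : (pp : ℕ) ≠ l)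
    {t : ℕ} (ht : 0 < t) (hpt : ¬ (pp : ℕ) ∣ t)
    (hpole : ∀ v : HeightOneSpectrum (𝓞 ℚ), Rat.HeightOneSpectrum.natGenerator v = pp →
      Literature.IUT.LogVolume.ord ℚ v (Cor22.jInv q₀) = -(2 * (t : ℤ))) :
    letI := T.instFieldF; letI := T.instNumberFieldF; letI := T.instAlgebraF; letI := T.instFieldK
    letI := T.instNumberFieldK; letI := T.instAlgebraK; letI := T.instFieldFbar; letI := T.instAlgebraFbar
    letI := T.instAlgebraKFbar; letI := T.instIsElliptic
    haveI : Fact (pp : ℕ).Prime := ⟨pp.2⟩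
    ∀ x₀ : (thetaIndex (pilotDataOfK T.D T.K)).Fibre (.inr pp),
      absRamificationIdx (pp : ℕ) (kOf (pilotDataOfK T.D T.K) pp.1 x₀) = pp * (pp - 1) * (p' / Nat.gcd p' t) * l := by
  letI := T.instFieldF; letI := T.instNumberFieldF; letI := T.instAlgebraF; letI := T.instFieldK
  letI := T.instNumberFieldK; letI := T.instAlgebraK; letI := T.instFieldFbar; letI := T.instAlgebraFbar
  letI := T.instAlgebraKFbar; letI := T.instIsElliptic
  haveI : Fact (pp : ℕ).Prime := ⟨pp.2⟩
  have hp2 : (pp : ℕ) ≠ 2 := by rcases hpq with ⟨h, -⟩ | ⟨h, -⟩ <;> omega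
  have hpole' : ∀ v : HeightOneSpectrum (𝓞 ℚ), Rat.HeightOneSpectrum.natGenerator v = pp →
      Literature.IUT.LogVolume.ord ℚ v (Cor22.jInv q₀) < 0 := fun v hv => by
    rw [hpole v hv]
    have : (0 : ℤ) < t := by exact_mod_cast ht
    linarith
  set X := pilotDataOfK T.D T.K with hXdef
  intro x₀
  rw [GenuineK.absRamificationIdx_kOf_eq_mul_prime_ratPoint T pp hp2 hpl hpole' x₀]
  set u := placeOf X pp.1 x₀ with hudef
  have hpu : ((pp : ℕ) : 𝓞 T.K) ∈ u.asIdeal := natCast_mem_placeOf X pp.1 x₀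
  have hw : ((pp : ℕ) : 𝓞 T.F) ∈ (finBelow T.F T.K u).asIdeal := by
    rw [Cor22.natCast_mem_asIdeal_iff_residueChar_eq _ pp.2, residueChar_finBelow]
    exact residueChar_eq_of_natCast_mem pp.1 hpu
  rw [GenuineK.ramificationIdx_F_eq_wild_ratPoint T hpq ht hpt hpole (finBelow T.F T.K u) hw]

end Summit.ABC.IUTFork.Conditional

end
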